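import Mathlib
import Literature.Computability.Complexity.RangeAvoidance
import Literature.Computability.Complexity.SignDegreeXor
import Summits.PneNP.PneNP.Theorems.PstarPDT
import Summits.PneNP.PneNP.Theorems.PstarPDTFromSA
import Summits.PneNP.PneNP.Theorems.PstarPDTUpper
import Summits.PneNP.PneNP.Theorems.PstarFibrePolys
import Summits.PneNP.PneNP.Theorems.PstarSALevel
import Summits.PneNP.PneNP.Theorems.PstarTyped
import Summits.PneNP.PneNP.Theorems.PstarGapLinearised
import Summits.PneNP.PneNP.Theorems.PstarGraphQuadGapOne
import Summits.PneNP.PneNP.Theorems.PstarGraphQuadGapTwoForms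
import Summits.PneNP.PneNP.Theorems.PstarGapOneAll

/-!
# G-constraints: the `𝔽₂` calculus of `gval` (ROUND-24 item T24.17′, infrastructure G1/G2)

FRONTIER range-avoidance ladder, rung F-N3, ROUND 24 (cell `pnp-ideate`; restricted-model proof complexity — nothing here bears on
`P` versus `NP`).  For the reader-graph induction `PstarGapOneAll.GSat` (memo ROUND-24-PRESEED §13 R10(p); referee audit
AUDIT-r10p-gsat-g43, cares P4/P6/P7).

A G-CONSTRAINT is `gval I C G z = ⊕_{v∈C} z_v ⊕ ⊕_{g∈G} (z_{p_g} ∧ z_{q_g})` (`(p_g,q_g)` the AND slots `2,3` of `g`).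

* (G1, calculus) `bit_gval` — in `𝔽₂`: `Σ_{v∈C} z_v + Σ_{g∈G} z_{p_g} z_{q_g}`; `gval_update_of_forall_ne` (a variable outside `C` and
  outside the AND pairs of `G` is irrelevant), `bit_gval_update_xor` (typed instances: an XOR-slot variable moves `gval` by
  `[t ∈ C]·(change)`), **`gval_reader`** (READER SUBSTITUTION, memo (p)(b)): for a pure output `g ∉ G` with XOR slots `t ≠ t'`,
  `gval I (C ∆ {t,t'}) (insert g G) z = gval I C G z ⊕ I.eval z g`.
* (G2, constancy) `gval_false` (all-false point), `gval_indicator_mem` (a lone `C`-variable switched on gives `true` when the AND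
  pairs are non-degenerate), `gval_indicator_pair` (a lone `G`-pair switched on gives `true` when `C` avoids it and the pairs of `G`
  are distinct and non-degenerate), and the characterisation **`gval_nonconst_iff`**: under non-degenerate, pairwise distinct AND pairs
  (both automatic from `IsPure` + `SimpleOverlap`, `andPairs_simple`), `gval I C G` takes both values iff `C ≠ ∅ ∨ G ≠ ∅` — the
  "constant polynomial ⇒ no monomials" step (P6) in semantic form.
-/

set_option linter.dupNamespace false -- `Summit.PneNP.PneNP.…`: summit = sub-problem name (D-0017 single-conjunct layout)

open Finset Literature.Computability.Complexity
open scoped symmDiff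
open Summit.PneNP.PneNP.Theorems.PstarPDT (parity bit_eval)
open Summit.PneNP.PneNP.Theorems.PstarPDTFromSA (parity_congr)
open Summit.PneNP.PneNP.Theorems.PstarFibrePolys (bit bit_xor bit_and bit_injective)
open Summit.PneNP.PneNP.Theorems.PstarTyped (Typed)
open Summit.PneNP.PneNP.Theorems.PstarSALevel (varSet SimpleOverlap)
open Summit.PneNP.PneNP.Theorems.PstarGapLinearised (andPair)
open Summit.PneNP.PneNP.Theorems.PstarGraphQuadGapOne (bit_parity)
open Summit.PneNP.PneNP.Theorems.PstarGraphQuadGapTwoForms (sum_symmDiff_zmod2)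
open Summit.PneNP.PneNP.Theorems.PstarGapOneAll (gval)

namespace Summit.PneNP.PneNP.Theorems.PstarGConstraint

variable {n m : ℕ}

/-! ## Small `𝔽₂` facts -/

/-- In `𝔽₂`, `x + x = 0`. -/
private theorem zmod2_add_self (x : ZMod 2) : x + x = 0 := by
  revert x; decide

/-- A natural number cast to `𝔽₂` is the bit of its parity. -/
private theorem natCast_eq_bit_odd (k : ℕ) : (k : ZMod 2) = bit (decide (Odd k)) := by
  by_cases h : Odd k
  · rw [ZMod.natCast_eq_one_iff_odd.2 h]; simp [h, bit]
  · rw [ZMod.natCast_eq_zero_iff_even.2 (Nat.not_odd_iff_even.1 h)]; simp [h, bit]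

/-- `[b ∧ c] = bit b · bit c` in `𝔽₂`. -/
private theorem ite_and_eq_bit_mul (b c : Bool) : (if b = true ∧ c = true then (1 : ZMod 2) else 0) = bit b * bit c := by
  cases b <;> cases c <;> decide

/-! ## G1: the calculus -/

/-- **`gval` in `𝔽₂`**: `Σ_{v∈C} z_v + Σ_{g∈G} z_{p_g}·z_{q_g}`. -/
theorem bit_gval (I : LocalMap 4 n m) (C : Finset (Fin n)) (G : Finset (Fin m)) (z : Fin n → Bool) :
    bit (gval I C G z) = ∑ v ∈ C, bit (z v) + ∑ g ∈ G, bit (z (I.vars g 2)) * bit (z (I.vars g 3)) := by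
  unfold gval
  rw [bit_xor, bit_parity, ← natCast_eq_bit_odd, ← sum_boole]
  exact congrArg _ (sum_congr rfl fun g _ => ite_and_eq_bit_mul _ _)

/-- A variable outside `C` and outside every AND pair of `G` does not affect `gval`. -/
theorem gval_update_of_forall_ne (I : LocalMap 4 n m) {C : Finset (Fin n)} {G : Finset (Fin m)} (z : Fin n → Bool) {v : Fin n}
    (hC : v ∉ C) (hG : ∀ g ∈ G, I.vars g 2 ≠ v ∧ I.vars g 3 ≠ v) (b : Bool) :
    gval I C G (Function.update z v b) = gval I C G z := by
  apply bit_injective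
  rw [bit_gval, bit_gval]
  congr 1
  · exact sum_congr rfl fun w hw => by
      have hne : w ≠ v := fun h => hC (h ▸ hw)
      rw [Function.update_of_ne hne]
  · exact sum_congr rfl fun g hg => by rw [Function.update_of_ne (hG g hg).1, Function.update_of_ne (hG g hg).2]

/-- On a typed instance, updating an XOR-slot variable `t` moves `gval` by `[t ∈ C]·(bit b + bit (z t))`. -/
theorem bit_gval_update_xor (I : LocalMap 4 n m) (hT : Typed I) (C : Finset (Fin n)) (G : Finset (Fin m)) (z : Fin n → Bool)
    {j : Fin m} {s : Fin 4} (hs : s.val < 2) (b : Bool) :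
    bit (gval I C G (Function.update z (I.vars j s) b)) =
      bit (gval I C G z) + if I.vars j s ∈ C then bit b + bit (z (I.vars j s)) else 0 := by
  rw [bit_gval, bit_gval]
  have hG : ∑ g ∈ G, bit (Function.update z (I.vars j s) b (I.vars g 2)) * bit (Function.update z (I.vars j s) b (I.vars g 3)) =
      ∑ g ∈ G, bit (z (I.vars g 2)) * bit (z (I.vars g 3)) :=
    sum_congr rfl fun g _ => by
      rw [Function.update_of_ne fun h => hT j g s 2 hs (by decide) h.symm,
        Function.update_of_ne fun h => hT j g s 3 hs (by decide) h.symm]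
  have hC : ∑ v ∈ C, bit (Function.update z (I.vars j s) b v) =
      ∑ v ∈ C, bit (z v) + if I.vars j s ∈ C then bit b + bit (z (I.vars j s)) else 0 := by
    have key : ∀ w ∈ C, bit (Function.update z (I.vars j s) b w) =
        bit (z w) + if w = I.vars j s then bit b + bit (z (I.vars j s)) else 0 := by
      intro w _
      by_cases h : w = I.vars j s
      · subst h
        rw [Function.update_self, if_pos rfl]
        have := zmod2_add_self (bit (z (I.vars j s)))
        linear_combination -this
      · rw [Function.update_of_ne h, if_neg h, add_zero]
    rw [sum_congr rfl key, sum_add_distrib, sum_ite_eq']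
  rw [hC, hG]
  ring

/-- **Reader substitution** (memo (p)(b)).  For a pure output `g ∉ G` (XOR slots `t, t'`, AND pair `p, q`):
`gval (C ∆ {t,t'}) (G ∪ {g}) = gval C G ⊕ out_g`, since `out_g = t ⊕ t' ⊕ p·q`. -/
theorem gval_reader (I : LocalMap 4 n m) (hI : I.IsPure xorAndPred) (C : Finset (Fin n)) {G : Finset (Fin m)} {g : Fin m}
    (hg : g ∉ G) (z : Fin n → Bool) :
    gval I (C ∆ {I.vars g 0, I.vars g 1}) (insert g G) z = xor (gval I C G z) (I.eval z g) := by
  classical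
  apply bit_injective
  have h01 : I.vars g 0 ≠ I.vars g 1 := fun h => absurd (hI.2 g h) (by decide)
  rw [bit_xor, bit_gval, bit_gval, sum_symmDiff_zmod2, sum_pair h01, sum_insert hg, bit_eval hI z g]
  ring

/-! ## G2: constancy -/

/-- At the all-`false` point `gval` is `false`. -/
theorem gval_false (I : LocalMap 4 n m) (C : Finset (Fin n)) (G : Finset (Fin m)) : gval I C G (fun _ => false) = false := by
  apply bit_injective
  rw [bit_gval]
  simp [bit]

/-- Switching on a single variable of `C` gives `true`, provided no AND pair of `G` is degenerate. -/
theorem gval_indicator_mem (I : LocalMap 4 n m) {C : Finset (Fin n)} {G : Finset (Fin m)}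
    (hnd : ∀ g ∈ G, I.vars g 2 ≠ I.vars g 3) {v : Fin n} (hv : v ∈ C) :
    gval I C G (fun w => decide (w = v)) = true := by
  classical
  apply bit_injective
  rw [bit_gval]
  have hC : ∑ w ∈ C, bit (decide (w = v)) = 1 := by
    rw [sum_eq_single_of_mem v hv fun w _ hne => by simp [hne, bit]]
    simp [bit]
  have hG : ∑ g ∈ G, bit (decide (I.vars g 2 = v)) * bit (decide (I.vars g 3 = v)) = 0 := by
    refine sum_eq_zero fun g hg => ?_
    by_cases h2 : I.vars g 2 = v
    · have h3 : I.vars g 3 ≠ v := fun h => hnd g hg (h2.trans h.symm)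
      simp [h3, bit]
    · simp [h2, bit]
  rw [hC, hG]
  decide

/-- Switching on the AND pair of one `g₀ ∈ G` gives `true`, provided `C` avoids that pair and the pairs of `G` are non-degenerate
and distinct from it. -/
theorem gval_indicator_pair (I : LocalMap 4 n m) {C : Finset (Fin n)} {G : Finset (Fin m)}
    (hnd : ∀ g ∈ G, I.vars g 2 ≠ I.vars g 3) {g₀ : Fin m} (hg₀ : g₀ ∈ G)
    (hdist : ∀ g ∈ G, g ≠ g₀ → andPair I g ≠ andPair I g₀) (hC2 : I.vars g₀ 2 ∉ C) (hC3 : I.vars g₀ 3 ∉ C) :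
    gval I C G (fun w => decide (w = I.vars g₀ 2 ∨ w = I.vars g₀ 3)) = true := by
  classical
  apply bit_injective
  rw [bit_gval]
  have hC : ∑ w ∈ C, bit (decide (w = I.vars g₀ 2 ∨ w = I.vars g₀ 3)) = 0 := by
    refine sum_eq_zero fun w hw => ?_
    have h2 : w ≠ I.vars g₀ 2 := fun h => hC2 (h ▸ hw)
    have h3 : w ≠ I.vars g₀ 3 := fun h => hC3 (h ▸ hw)
    simp [h2, h3, bit]
  have hG : ∑ g ∈ G, bit (decide (I.vars g 2 = I.vars g₀ 2 ∨ I.vars g 2 = I.vars g₀ 3)) *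
      bit (decide (I.vars g 3 = I.vars g₀ 2 ∨ I.vars g 3 = I.vars g₀ 3)) = 1 := by
    rw [sum_eq_single_of_mem g₀ hg₀ fun g hg hne => ?_]
    · simp [bit]
    · -- another pair inside `{p₀, q₀}` would be the same pair
      by_contra hne0
      have hboth : (I.vars g 2 = I.vars g₀ 2 ∨ I.vars g 2 = I.vars g₀ 3) ∧
          (I.vars g 3 = I.vars g₀ 2 ∨ I.vars g 3 = I.vars g₀ 3) := by
        revert hne0
        by_cases h2 : I.vars g 2 = I.vars g₀ 2 ∨ I.vars g 2 = I.vars g₀ 3 <;>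
          by_cases h3 : I.vars g 3 = I.vars g₀ 2 ∨ I.vars g 3 = I.vars g₀ 3 <;> simp [h2, h3, bit]
      apply hdist g hg hne
      unfold PstarGapLinearised.andPair
      have hgnd := hnd g hg
      have hg₀nd := hnd g₀ hg₀
      rcases hboth with ⟨h2 | h2, h3 | h3⟩
      · exact absurd (h2.trans h3.symm) hgnd
      · rw [h2, h3]
      · rw [h2, h3, pair_comm]
      · exact absurd (h2.trans h3.symm) hgnd
  rw [hC, hG]
  decide

/-- On a pure instance with simple overlaps the AND pairs of a set of outputs are non-degenerate and pairwise distinct. -/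
theorem andPairs_simple (I : LocalMap 4 n m) (hI : I.IsPure xorAndPred) (hS : SimpleOverlap I) (G : Finset (Fin m)) :
    (∀ g ∈ G, I.vars g 2 ≠ I.vars g 3) ∧ (∀ g ∈ G, ∀ g' ∈ G, g ≠ g' → andPair I g ≠ andPair I g') := by
  refine ⟨fun g _ h => absurd (hI.2 g h) (by decide), fun g _ g' _ hne heq => ?_⟩
  have h23 : I.vars g 2 ≠ I.vars g 3 := fun h => absurd (hI.2 g h) (by decide)
  have hsub : andPair I g ⊆ varSet I g ∩ varSet I g' := by
    intro v hv
    rw [mem_inter]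
    refine ⟨PstarGapLinearised.andPair_subset_varSet I g hv, ?_⟩
    rw [heq] at hv
    exact PstarGapLinearised.andPair_subset_varSet I g' hv
  have hcard : (andPair I g).card = 2 := by
    unfold PstarGapLinearised.andPair
    exact card_pair h23
  have := (card_le_card hsub).trans (hS g g' hne)
  omega

/-- **Non-constancy of a G-constraint** (P6 in semantic form): with non-degenerate, pairwise distinct AND pairs, `gval I C G` takes
both values iff `C ≠ ∅ ∨ G ≠ ∅`. -/
theorem gval_nonconst_iff (I : LocalMap 4 n m) {C : Finset (Fin n)} {G : Finset (Fin m)}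
    (hnd : ∀ g ∈ G, I.vars g 2 ≠ I.vars g 3) (hdist : ∀ g ∈ G, ∀ g' ∈ G, g ≠ g' → andPair I g ≠ andPair I g') :
    (∃ z z' : Fin n → Bool, gval I C G z ≠ gval I C G z') ↔ (C ≠ ∅ ∨ G ≠ ∅) := by
  classical
  constructor
  · rintro ⟨z, z', hne⟩
    by_contra h
    push Not at h
    obtain ⟨rfl, rfl⟩ := h
    apply hne
    have h0 : ∀ w : Fin n → Bool, gval I ∅ ∅ w = false := fun w => by
      apply bit_injective; rw [bit_gval]; simp [bit]
    rw [h0, h0]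
  · intro h
    by_cases hC : C = ∅
    · subst hC
      have hG : G ≠ ∅ := h.resolve_left fun h => h rfl
      obtain ⟨g₀, hg₀⟩ := nonempty_iff_ne_empty.2 hG
      refine ⟨fun w => decide (w = I.vars g₀ 2 ∨ w = I.vars g₀ 3), fun _ => false, ?_⟩
      rw [gval_indicator_pair I hnd hg₀ (fun g hg hne => hdist g hg g₀ hg₀ hne) (notMem_empty _) (notMem_empty _),
        gval_false]
      decide
    · obtain ⟨v, hv⟩ := nonempty_iff_ne_empty.2 hC
      refine ⟨fun w => decide (w = v), fun _ => false, ?_⟩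
      rw [gval_indicator_mem I hnd hv, gval_false]
      decide

/-- The contrapositive used by the induction: if a G-constraint misses one value on ALL assignments, it has no variables and no
monomials. -/
theorem eq_empty_of_gval_const (I : LocalMap 4 n m) {C : Finset (Fin n)} {G : Finset (Fin m)}
    (hnd : ∀ g ∈ G, I.vars g 2 ≠ I.vars g 3) (hdist : ∀ g ∈ G, ∀ g' ∈ G, g ≠ g' → andPair I g ≠ andPair I g')
    {b : Bool} (hconst : ∀ z, gval I C G z = b) : C = ∅ ∧ G = ∅ := by
  by_contra h
  have h' : C ≠ ∅ ∨ G ≠ ∅ := by tauto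
  obtain ⟨z, z', hne⟩ := (gval_nonconst_iff I hnd hdist).2 h'
  exact hne (by rw [hconst z, hconst z'])

end Summit.PneNP.PneNP.Theorems.PstarGConstraint
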